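import Literature.NumberTheory.EllipticCurves.Kato2004.LocPKernelRankOne
import Literature.NumberTheory.EllipticCurves.Kato2004.LocPKernelRankOnePlumbing
import Literature.NumberTheory.EllipticCurves.Kato2004.IwasawaH1ReductionSeparated
import Literature.NumberTheory.EllipticCurves.StrictSelmerTorsionLevelUniformBound
import Literature.NumberTheory.EllipticCurves.HasseWeilGoodReduction
import HarnessLib

/-!
# Kato 2004 §14.1 / (14.9.3) read in rank one — the named fact
# `Kato2004.locP_kernel_isTorsion_of_rankOne` DISCHARGED (`locP_kernel_isTorsion_of_rankOne_holds`)

Topic `NumberTheory/EllipticCurves`, sub-directory `Kato2004` (namespace = path).  Cell `bsd-cn100`,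
prover seat `bsd-cn100-s2-c3` (g9).  `Proofs`-style file: theorems only (no definition, no named
fact, no `sorry`, no instance).

## What

`Kato2004.locP_kernel_isTorsion_of_rankOne` (file `Kato2004/LocPKernelRankOne.lean`, the 11th
conjunct of `stub_refereedInputs` of the registered lines `kato-zeta-perrin-riou` on
stmt-BirchSwinnertonDyer-19080 / -19160) says: for `W/ℚ` elliptic, `p` prime, `κ` a
`ℤ_p`-extension datum and an INTEGRAL class `x ∈ H¹(ℤ[1/p], T_pW)` at the bottom layer, if
`rank_ℤ W(ℚ) = 1`, `Ш(W)[p^∞]` is finite and `loc_p x ≡ 0 (mod p^k)` for every `k`, then `x` is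
`ℤ_p`-torsion.  This file proves it from tree theorems (`locP_kernel_isTorsion_of_rankOne_holds`);
the assembly is first written against the local input (L2) as an explicit hypothesis
(`…_of_localBound`), then (L2) is supplied from seat `bsd-cn100-transfer-2`'s bad-place lemma
(`SelmerLocalConditionUnramifiedTorsion.lean`, p483112) made UNIFORM in the level (§4):

* §§1–4 (file `Kato2004/LocPKernelRankOnePlumbing.lean`): `⊤`-level bookkeeping on continuous
  `H¹` (`layerZeroToTop`, `ofTopSubgroup`), the DIALECT BRIDGE (L3) integral ⟹ `unramifiedKer`,
  the local inputs at `p` (`res = 0`, `λ : W(ℚ_v) → ℤ_p`), at `∞` (factor `2`) and at the bad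
  places (the uniform bound (L2) `exists_uniform_nsmul_mem_selmerLocalKer_of_mem_unramifiedKer`);
* this file: the assembly `locP_kernel_isTorsion_of_rankOne_of_localBound` (against (L2) as an
  explicit hypothesis) and the discharge `locP_kernel_isTorsion_of_rankOne_holds`.

## Proof of the fact (Kato §14.1 + (14.9.3) in rank one; [ABS] App. A §10.1.3)

Move `x` to `H¹(Γ_ℚ, T_pW)` (`layerZeroToTop`, an isomorphism).  For each `k` let
`c_k ∈ H¹(ℚ, W[p^k])` be its reduction.  Then `res_p c_k = 0` (hypothesis), `c_k` is unramified
at every `𝔓 ∤ p` (§2), hence satisfies the `p^k`-Selmer local condition at every good `v ≠ p`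
(Milne I.3.8, tree `unramifiedKer_le_selmerLocalKer_of_hasGoodReductionAt`), at the finitely
many bad `v ≠ p` after multiplication by the uniform exponent of (L2), at `∞` after
multiplication by `2`, and at `p` trivially: `T • c_k ∈ Sel^{(p^k)}(W/ℚ)` with `res_p = 0`, for ONE
`T ≠ 0`.  By the finite-level uniform rank-one lemma
(`exists_uniform_nsmul_eq_zero_of_mem_selmerGroup_of_res_eq_zero`: `Ш[p^∞]` finite, Kummer
theory, `W(ℚ) = ℤP₁ ⊕ tors`, `λ`) ONE `M ≠ 0` kills all `T • c_k`.  So every reduction of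
`(MT) • x` vanishes, hence `(MT) • x = 0` (Rubin ES App. B Prop. B.2.3, tree
`Kato2004.eq_zero_of_forall_reduceH1Pk_eq_zero`, seat transfer-2's p480252), and the `p`-part of
`MT` already kills `x` (`ℤ_p`-module).

References: K. Kato, Astérisque 295 (2004) §14.1, §14.9 (14.9.3), §8.2 / Lemma 8.5; A. Burungale,
C. Skinner, App. A to arXiv:2210.10730 §10.1.3; K. Rubin, *Euler Systems* App. B Prop. B.2.3;
J. Milne, *ADT* I Prop. 3.8; J. Silverman, *AEC* VII.6.3, VIII.§2, X.§4; C. Skinner, Ann. of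
Math. 191 (2020) §2.2.
-/

noncomputable section

open scoped Classical NumberField

open CategoryTheory Field IsDedekindDomain NumberField
open Literature.NumberTheory.GaloisRepresentations
open Literature.NumberTheory.EllipticCurves Literature.NumberTheory.EllipticCurves.Kato2004
open Literature.NumberTheory.EllipticCurves.Kato2004.EulerSystemValues
open WeierstrassCurve (geomPoints geomTorsion galH1Torsion selmerLocalKer selmerGroup torsionPoints
  torsionGaloisModule)

namespace Literature.NumberTheory.EllipticCurves.Kato2004

/-! ## The assembly -/

section Assembly

/-- **The local bound (L2)** in the shape consumed below (for `W/ℚ`): at every finite place `v`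
there is ONE `t ≠ 0` such that for every `n ≠ 0` every class of `H¹(ℚ, W[n])` unramified at all
primes above `v` satisfies the `n`-Selmer local condition at `v` after multiplication by `t`
(at good `v` one may take `t = 1`, Milne I.3.8; at bad `v` the unramified classes form a group of
order `#W(ℚ_v)[n] ≤ #W(ℚ_v)_{tors}`). Stated as a `Prop`-valued hypothesis shape, NOT a named fact
(supplied by `LocPKernelRankOnePlumbing` §4). [cite: MilneADT2006, Ch. I Prop. 3.8 and Lemma 3.3] -/
theorem locP_kernel_isTorsion_of_rankOne_of_localBound
    (hL2 : ∀ (W : WeierstrassCurve ℚ) [W.IsElliptic] (v : HeightOneSpectrum (𝓞 ℚ)),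
      ∃ t : ℕ, t ≠ 0 ∧ ∀ (n : ℤ), n ≠ 0 → ∀ c : galH1Torsion W n,
        (∀ 𝔓 ∈ v.primesAbove, c ∈ unramifiedKer (geomTorsion W n) 𝔓) →
          t • c ∈ selmerLocalKer W (v.adicCompletion ℚ) n) :
    locP_kernel_isTorsion_of_rankOne := by
  intro W _ p _ _ κ x hx hrank hsha hloc
  haveI := hsha
  have hp : p.Prime := Fact.out
  -- Step 1: move to `⊤`
  set x' : H1 (tateRep W p) ⊤ := layerZeroToTop W p κ x with hx'
  have hx'int : x' ∈ integralH1 (tateRep W p) p ⊤ := layerZeroToTop_mem_integralH1 W p κ hx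
  -- the finitely many bad places and the uniform local exponents
  obtain ⟨S, hS⟩ : ∃ S : Finset (HeightOneSpectrum (𝓞 ℚ)),
      ∀ v, v ∉ S → W.HasGoodReductionAt v := by
    have h := WeierstrassCurve.eventually_hasGoodReductionAt W
    rw [Filter.eventually_cofinite] at h
    exact ⟨h.toFinset, fun v hv => by_contra fun hbad => hv (h.mem_toFinset.mpr hbad)⟩
  choose t ht0 ht using fun v : HeightOneSpectrum (𝓞 ℚ) => hL2 W v
  set T : ℕ := 2 * ∏ v ∈ S, t v with hT
  have hT0 : T ≠ 0 := Nat.mul_ne_zero two_ne_zero (Finset.prod_ne_zero_iff.mpr fun v _ => ht0 v)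
  -- `λ` at the place above `p` and the uniform rank-one annihilator
  obtain ⟨lam, hlam⟩ := exists_addMonoidHom_padicInt_adicCompletion W p
  haveI : PerfectField ((primePlace p).adicCompletion ℚ) := by
    haveI : CharZero ((primePlace p).adicCompletion ℚ) := charZero_adicCompletion _
    infer_instance
  obtain ⟨M, hM0, hM⟩ := exists_uniform_nsmul_eq_zero_of_mem_selmerGroup_of_res_eq_zero W p
    ((primePlace p).adicCompletion ℚ) lam hlam hrank
  -- Step 2: the reductions `c_k` and their Selmer multiples
  have hck : ∀ k : ℕ,
      (M * T) • (ofTopSubgroup (W.torsionGaloisModule ((p : ℤ) ^ k)).toTopRep 1).hom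
        (reduceH1Pk W p k ⊤ x') = 0 := by
    intro k
    set n : ℤ := (p : ℤ) ^ k with hn
    have hn0 : n ≠ 0 := pow_ne_zero k (Int.natCast_ne_zero.mpr hp.ne_zero)
    set c : galH1Torsion W n :=
      (ofTopSubgroup (W.torsionGaloisModule n).toTopRep 1).hom (reduceH1Pk W p k ⊤ x') with hc
    have hrint : reduceH1Pk W p k ⊤ x' ∈ integralH1 (W.torsionGaloisModule n) p ⊤ :=
      reduceH1Pk_mem_integralH1 W p k ⊤ hx'int
    -- (2b) `res_p c = 0`
    have hres : galoisCohomology.res (W.torsionGaloisModule n) ((primePlace p).adicCompletion ℚ) 1 c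
        = 0 := by
      have h := hloc k
      rw [locModPk_apply] at h
      exact h
    -- (2a) unramified away from `p`
    have hunr : ∀ v : HeightOneSpectrum (𝓞 ℚ),
        ((Rat.HeightOneSpectrum.primesEquiv v : Nat.Primes) : ℕ) ≠ p →
          ∀ 𝔓 ∈ v.primesAbove, c ∈ unramifiedKer (geomTorsion W n) 𝔓 :=
      fun v hv 𝔓 h𝔓 => ofTopSubgroup_mem_unramifiedKer_of_mem_integralH1 W p n hrint hv h𝔓
    -- places `v ≠ primePlace p` have residue characteristic `≠ p`
    have hne : ∀ v : HeightOneSpectrum (𝓞 ℚ), v ≠ primePlace p →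
        ((Rat.HeightOneSpectrum.primesEquiv v : Nat.Primes) : ℕ) ≠ p := by
      intro v hv h
      apply hv
      apply (Rat.HeightOneSpectrum.primesEquiv (R := 𝓞 ℚ)).injective
      rw [primesEquiv_primePlace]
      exact Subtype.ext h
    -- (2c)–(2f) `T • c ∈ Sel^{(n)}` with `res_p (T • c) = 0`
    have hsel : T • c ∈ selmerGroup W n := by
      rw [WeierstrassCurve.mem_selmerGroup_iff]
      refine ⟨fun v => ?_, fun w => ?_⟩
      · by_cases hvp : v = primePlace p
        · subst hvp
          exact AddSubgroup.nsmul_mem _ (mem_selmerLocalKer_of_res_eq_zero W _ c hres) T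
        · by_cases hvS : v ∈ S
          · have h1 : t v • c ∈ selmerLocalKer W (v.adicCompletion ℚ) n :=
              ht v n hn0 c (hunr v (hne v hvp))
            obtain ⟨q, hq⟩ : t v ∣ T :=
              (Finset.dvd_prod_of_mem t hvS).trans (Dvd.intro_left 2 rfl)
            rw [hq, mul_comm, mul_nsmul']
            exact AddSubgroup.nsmul_mem _ h1 q
          · obtain ⟨𝔓, h𝔓⟩ := v.primesAbove_nonempty
            exact AddSubgroup.nsmul_mem _
              (W.unramifiedKer_le_selmerLocalKer_of_hasGoodReductionAt (hS v hvS) n h𝔓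
                (hunr v (hne v hvp) 𝔓 h𝔓)) T
      · rw [hT, mul_comm, mul_nsmul']
        exact AddSubgroup.nsmul_mem _ (two_nsmul_mem_selmerLocalKer_infinitePlace W w c) _
    have hresT : galoisCohomology.res (W.torsionGaloisModule n) ((primePlace p).adicCompletion ℚ) 1
        (T • c) = 0 := by
      let r : galH1Torsion W n →+ galoisCohomology (GaloisRep.restrictField
          ((primePlace p).adicCompletion ℚ) (W.torsionGaloisModule n)) 1 :=
        galoisCohomology.res (W.torsionGaloisModule n) ((primePlace p).adicCompletion ℚ) 1
      have hr : r c = 0 := hres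
      change r (T • c) = 0
      rw [map_nsmul, hr, smul_zero]
    -- Step 3: the uniform annihilator
    have h := hM k (T • c) hsel hresT
    rwa [← mul_nsmul'] at h
  -- Step 4: all reductions of `(M T) • x'` vanish, so `(M T) • x' = 0`
  have hred : ∀ k : ℕ, reduceH1Pk W p k ⊤ ((M * T) • x') = 0 := by
    intro k
    apply eq_zero_of_ofTopSubgroup_eq_zero
    rw [map_nsmul, map_nsmul]
    exact hck k
  have hMT : ((M * T : ℕ) : ℤ_[p]) • x' = 0 := by
    rw [Nat.cast_smul_eq_nsmul]
    exact eq_zero_of_forall_reduceH1Pk_eq_zero W p ⊤ _ hred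
  -- Step 5: extract the `p`-power and return to the bottom layer
  obtain ⟨j, hj⟩ := exists_pow_smul_eq_zero_of_natCast_smul_eq_zero p (Nat.mul_ne_zero hM0 hT0) x' hMT
  refine ⟨j, eq_zero_of_layerZeroToTop_eq_zero W p κ _ ?_⟩
  rw [layerZeroToTop_smul]
  exact hj

/-- **DISCHARGE of the named fact `Kato2004.locP_kernel_isTorsion_of_rankOne`** (Kato 2004
§14.1 + (14.9.3) read in rank one with `Ш[p^∞]` finite; [ABS] App. A §10.1.3: «Since `Sel_st(E)`
is finite, it further follows that `0 ≠ loc_p(z_E)`»): for every elliptic `W/ℚ`, every prime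
`p`, every `ℤ_p`-extension datum and every integral class `x ∈ H¹(ℤ[1/p], T_pW)`, if
`rank_ℤ W(ℚ) = 1`, `Ш(W)[p^∞]` is finite and `loc_p x ≡ 0 (mod p^k)` for all `k`, then `x` is
`ℤ_p`-torsion — now a THEOREM (the local bound (L2) fed by
`exists_uniform_nsmul_mem_selmerLocalKer_of_mem_unramifiedKer`). This closes the 11th conjunct
of `stub_refereedInputs` of the registered lines `kato-zeta-perrin-riou`
(stmt-BirchSwinnertonDyer-19080 / -19160) by name.
[cite: Kato2004Asterisque, §14.9 (14.9.3) (p. 240), §14.1 (p. 235)]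
[cite: AlpogeBhargavaShnidman2022, App. A §10.1.3 (p. 34)] -/
theorem locP_kernel_isTorsion_of_rankOne_holds : locP_kernel_isTorsion_of_rankOne :=
  locP_kernel_isTorsion_of_rankOne_of_localBound fun W _ v =>
    exists_uniform_nsmul_mem_selmerLocalKer_of_mem_unramifiedKer W v

end Assembly

end Literature.NumberTheory.EllipticCurves.Kato2004

end
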